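import Summits.QuantumFields.BalabanUV.T4Continuum.Spine.NE1p.DressedSmallFieldRecordLabelsKillSlotLetters
import Summits.QuantumFields.BalabanUV.T4Continuum.Support.GaussianLettersRadiusLocated

/-!
# T⁴ programme, spine estimate NE1′ (node O3b/H2) — THE CLASS OPERATOR RADIUS, LOCATED, AT THE LABELS OF RECORD: S65 §1's two ENDs
# with the substrate's two radius smallnesses `hbud` ∕ `hmq` DISCHARGED from uniform letter bounds and three scalar clauses per level
# (PART B of row S67; PART A = `Support/GaussianLettersRadiusLocated`)

Cell `pub-balaban`, sub-cell `t4`, BINDER-OWNERS row NE1′ (owner lineage t4-ne1p-p1); NE1′ formalisation crew, unit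
b2b-balaban-t4-ne1p-formalise-leaf-05, generation 13; crew row S67 ∕ DAG N29zzzzzr PART B of `t4/formal/NE1p/LEAVES.md` (INTENT `CLAIMS.log`
l.25153; BOOKED typer R-T155 l.25330; X248).  ADDITIVE — imports this lineage's S65 PART 1 `Spine/NE1p/DressedSmallFieldRecordLabelsKillSlotLetters`
and PART A `Support/GaussianLettersRadiusLocated` ONLY; THEOREMS ONLY (0 `def`, 0 `def … : Prop`, 0 cite, 0 sorry); nothing of S65 ∕ W91 ∕ S30 ∕
the substrate restated — used BY NAME.

WHAT.  S65 §1 put W91 §3's two ENDs at the substrate's core letters of record with N1a's operator-letter blocks discharged into the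
substrate's scalar per-factor conditions; among those, the two RADIUS SMALLNESSES `hbud : ∀ k X j, detBudget (card (mI X j)) (β₀ X j)
(ϑ X j) (R′ k) < d₀ X j` and `hmq : ∀ k X j, card (mI X j)·ϑ X j·R′ k < γ X j` are families over ALL factors per level.  PART A locates
them: under UNIFORM letter bounds (`card (mI X j) ≤ m̄`, `β₀ ≤ β̄`, `0 ≤ ϑ ≤ ϑ̄`, `d̄ ≤ d₀`, `γ̄ ≤ γ`) they follow from THREE scalar clauses on
the one number `R′ k` — `R′ k ≤ 1`, `m̄!·m̄·max 1 (β̄ + ϑ̄)^{m̄−1}·ϑ̄·R′ k < d̄`, `m̄·ϑ̄·R′ k < γ̄`.  THIS PART re-fires S65 §1 with that supply: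
* **`attachedPart_locE_le_of_coreLettersOf_recordLabels_located`** ∕ **`muPart_locE_le_of_coreLettersOf_recordLabels_located`** — S65 §1's
  `attachedPart_∕muPart_locE_le_of_coreLettersOf_recordLabels` ONCE BY NAME each, `(hbud, hmq) := hbud_hmq_located …` (PART A ONCE each).
  CENSUS vs S65 §1 (binders, by name): MINUS = [`hbud`, `hmq`]; PLUS = [`mb`, `βb`, `ϑb`, `db`, `γb` (five scalars), `hcard`, `hβb`, `hϑ₀`,
  `hϑb`, `hdb`, `hγb` (uniform letter bounds), `hR₁`, `hRd`, `hRγ` (three scalar clauses per level)]; rest IDENTICAL; conclusions LITERALLY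
  S65's = W91's.

HONEST FRAMING.  Elementary arithmetic supplied by name ([folklore] kernel theorems only); the class radii stay (w6)-type bookkeeping of the
owner's skeleton (C-t4r2-363 (iii)) — this only trades two per-factor DISPLAYS for uniform letter bounds + an explicit polynomial radius
threshold; WHETHER the datum of record has uniformly bounded letters is the substrate's ∕ rows NE2–NE3's business, NOT claimed; (B1b)
RELOCATED as W91 words it, NOT discharged; FILTER by fiat; (B3-form) `hAmp` DISPLAYED; 0 binders instantiated on Bałaban's densities; no
numeral of print asserted; no wall item; wall v1.8 (words, not kind) does NOT move; R-t4r2-Q2 NOT met; NE1′ ⇐ the named binders — NOT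
printed, NOT proved; spine PROVED 0∕9; count 9.  Rung (B)+1 on ONE finite four-torus — NOT infinite volume, NOT a mass gap, NOT OS on ℝ⁴,
NOT Clay.  HONEST DEPENDENCY: continuum YM on T⁴ ⇐ BetaPertH ∧ nine spine estimates (0/9 proved); BetaPertH ⇐ (D1) ∧ (D4) ∧ CAP+tail;
G-an2-4 gates asym, D1 and NE2/3/4. -/

noncomputable section

namespace Summit.QuantumFields.BalabanUV.T4Continuum.NE1p.DressedSmallFieldRecordLabelsKillSlotLettersLocated

open scoped BigOperators Matrix
open Metric Set MeasureTheory
open Literature.MathematicalPhysics.QuantumFieldTheory.Balaban1983to89 (GaugeGroup)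
open Literature.MathematicalPhysics.QuantumFieldTheory.Balaban1983to89.B13Resummation (locE)
open Literature.MathematicalPhysics.QuantumFieldTheory.Balaban1983to89.B5Prop11Lower (nsq)
open Literature.MathematicalPhysics.QuantumFieldTheory.Balaban1983to89.TreeLengthTorus (TDom tsys torusTreeLen)
open Literature.MathematicalPhysics.QuantumFieldTheory.Balaban1983to89.TreeLengthTorusGeometry (tgeometry)
open Literature.MathematicalPhysics.QuantumFieldTheory.Balaban1983to89.B12TreeDecay (K₀)
open Summit.QuantumFields.BalabanUV.T4Continuum.B13OpDatum (OpDatum)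
open Summit.QuantumFields.BalabanUV.T4Continuum.B13HistMeasurable (MeasPotFrame B13HistM)
open Summit.QuantumFields.BalabanUV.T4Continuum.B13StepTermLabels (InnerLabel)
open Summit.QuantumFields.BalabanUV.T4Continuum.B13InnerData (Bnd)
open Summit.QuantumFields.BalabanUV.T4Continuum.B13DomainGeometryTR (domEmb)
open Summit.QuantumFields.BalabanUV.T4Continuum.SubstrateTwoRunsDriven (DrivenRuns)
open Summit.QuantumFields.BalabanUV.T4Continuum.SubstrateActivities (coreOf actOfLetters)
open Summit.QuantumFields.BalabanUV.T4Continuum.SubstrateGaussianLetters (gaussC linForm)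
open Summit.QuantumFields.BalabanUV.T4Continuum.SubstrateGaussianLettersBall (detBudget)
open Summit.QuantumFields.BalabanUV.T4Continuum.SubstrateSlotsOfRecord (ActLetters coreLettersOf SpeciesRec SlotLetters slotsOfRecord
  slotsOfRecord_act)
open Summit.QuantumFields.BalabanUV.T4Continuum.SubstrateNestedToriOfRecord (InnerLabel.ofTorus torusLabels)
open Summit.QuantumFields.BalabanUV.T4Continuum.SubstrateBondsOfCubes (bondsOfFineCubes)
open Summit.QuantumFields.BalabanUV.T4Continuum.TorusBlockRefinement (trefineDom)
open Summit.QuantumFields.BalabanUV.T4Continuum.GaussianLettersRadiusLocated (hbud_hmq_located)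
open Summit.QuantumFields.BalabanUV.T4Continuum.NE1p.DressedSmallFieldRecordLabelsKillSlotLetters
  (attachedPart_locE_le_of_coreLettersOf_recordLabels muPart_locE_le_of_coreLettersOf_recordLabels)

variable {G : Type} [GaugeGroup G] (D : DrivenRuns G) {k : ℕ} (hk : k + 1 + D.m' ≤ D.F.m + D.K) (P : MeasPotFrame D.carriers)

section Located


variable (Op : Type) [NormedAddCommGroup Op] [NormedSpace ℂ Op]
  (𝒵 : D.carriers.Dom → InnerLabel D.carriers.Dom (Bnd D.toTwoRuns) → Type) [∀ X j, Fintype (𝒵 X j)]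
  (dom : ∀ X j, 𝒵 X j → D.carriers.Dom)
  (Jc : D.carriers.Dom → InnerLabel D.carriers.Dom (Bnd D.toTwoRuns) → Type) [∀ X j, Fintype (Jc X j)]
  (V : D.carriers.Dom → InnerLabel D.carriers.Dom (Bnd D.toTwoRuns) → Type) [∀ X j, NormedAddCommGroup (V X j)]
  [∀ X j, InnerProductSpace ℝ (V X j)] [∀ X j, MeasurableSpace (V X j)] [∀ X j, BorelSpace (V X j)] [∀ X j, FiniteDimensional ℝ (V X j)]
  (mI : D.carriers.Dom → InnerLabel D.carriers.Dom (Bnd D.toTwoRuns) → Type) [∀ X j, Fintype (mI X j)] [∀ X j, DecidableEq (mI X j)]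

open Classical in
/-- **S65 §1's ATTACHED END WITH THE RADIUS SMALLNESSES LOCATED** (kernel; S65 §1 `attachedPart_locE_le_of_coreLettersOf_recordLabels`
ONCE BY NAME with `(hbud, hmq) := hbud_hmq_located …` — PART A once).  Binders = S65 §1's VERBATIM except MINUS [`hbud`, `hmq`] PLUS the
uniform letter bounds `hcard` ∕ `hβb` ∕ `hϑ₀` ∕ `hϑb` ∕ `hdb` ∕ `hγb` and the three scalar clauses `hR₁` ∕ `hRd` ∕ `hRγ` per level; conclusion
LITERALLY S65's = W91's. [folklore] -/
theorem attachedPart_locE_le_of_coreLettersOf_recordLabels_located {W : Set (ℕ → ℝ)}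
    {ctr : ℕ → (ℕ → ℝ) → D.carriers.BgB → Op × B13HistM P} {ROp RHist R' : ℕ → ℝ}
    (A : ∀ X j, ActLetters D P Op 𝒵 dom Jc V mI X j)
    {β₀ ϑ d₀ γ : D.carriers.Dom → InnerLabel D.carriers.Dom (Bnd D.toTwoRuns) → ℝ}
    (hroom : ∀ k, ROp k < R' k) (hR' : ∀ k, 0 ≤ R' k)
    -- the substrate's PRIMITIVE per-factor letter conditions (S-U3 currency) replacing W91's `hm` ∕ `hN` ∕ `hq`
    (hbase : ∀ X j ii jj, Measurable fun a => (A X j).base a ii jj)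
    (hrdm : ∀ X j ii jj (o' : Op), Measurable fun a => (A X j).rd a ii jj o')
    (hβ₀ : ∀ X j, 0 ≤ β₀ X j) (hd₀ : ∀ X j, 0 < d₀ X j)
    (hrd : ∀ X j a ii jj, ‖(A X j).rd a ii jj‖ ≤ ϑ X j)
    -- the CENTRE CONDITIONS at every class centre: entry bound, real determinant with real part `≥ d₀`, `γ`-coercivity
    (hctr : ∀ k, ∀ g ∈ W, ∀ (U : D.carriers.BgB) (X : D.carriers.Dom) (j : InnerLabel D.carriers.Dom (Bnd D.toTwoRuns))
      (a : (Jc X j ⊕ 𝒵 X j) → ℝ × ℝ),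
      (∀ ii jj, ‖linForm (A X j).base (A X j).rd (ctr k g U).1 a ii jj‖ ≤ β₀ X j) ∧
      ((linForm (A X j).base (A X j).rd (ctr k g U).1 a).det).im = 0 ∧ d₀ X j ≤ ((linForm (A X j).base (A X j).rd (ctr k g U).1 a).det).re ∧
      (∀ x : mI X j → ℂ, γ X j * nsq x ≤ (star x ⬝ᵥ (linForm (A X j).base (A X j).rd (ctr k g U).1 a *ᵥ x)).re))
    -- the two radius smallnesses LOCATED (PART A `hbud_hmq_located`): UNIFORM letter bounds + THREE scalar clauses per level
    {mb : ℕ} {βb ϑb db γb : ℝ} (hcard : ∀ X j, Fintype.card (mI X j) ≤ mb) (hβb : ∀ X j, β₀ X j ≤ βb)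
    (hϑ₀ : ∀ X j, 0 ≤ ϑ X j) (hϑb : ∀ X j, ϑ X j ≤ ϑb) (hdb : ∀ X j, db ≤ d₀ X j) (hγb : ∀ X j, γb ≤ γ X j)
    (hR₁ : ∀ k, R' k ≤ 1) (hRd : ∀ k, mb.factorial * mb * max 1 (βb + ϑb) ^ (mb - 1) * ϑb * R' k < db)
    (hRγ : ∀ k, mb * ϑb * R' k < γb)
    {g : ℕ → ℝ} (hg : g ∈ W) {U : D.carriers.BgB} {o : Op} {h₀ w : B13HistM P} {ϱ : ℝ}
    (hO : ‖o - (ctr (k + 1) g U).1‖ ≤ ROp (k + 1)) (hH : ‖h₀ - (ctr (k + 1) g U).2‖ + ϱ * ‖w‖ ≤ RHist (k + 1))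
    {A₀ A₁ Rkp r₁ : ℝ} (X₀ : (tsys 4 (D.cubesPerDir (k + 1))).Dom) (hA₀ : 0 ≤ A₀) (hA₁ : 0 ≤ A₁) (hr₁ : 0 ≤ r₁)
    (hrate : r₁ + 2 * (64 * Real.log 162) + 2 ≤ Rkp)
    (hsmall : (A₀ + ϱ * A₁) * Real.exp (5 * r₁ + 1) * K₀ 64 8 * 9 * 64 ≤ 1)
    {δ κ α₆ Rc s t : ℝ} (hα₆ : 0 ≤ α₆)
    (hκ : 64 * Real.log 162 + 1 ≤ δ * κ) (h229 : Real.exp 1 * K₀ 64 8 * 64 * α₆ ≤ 1)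
    (hs0 : 0 ≤ s) (hs1 : s ≤ 1) (ht : 0 ≤ t)
    (hRR : Rkp ≤ Rc - 64 * (Real.exp (Rc * 5) * s * Real.exp ((4 * (D.F.L : ℝ) ^ (4 * D.m')) * t)))
    -- (B3-form) on the filtered labels of record, on the EXPLICIT letters
    (hAmp : ∀ Z : (tsys 4 (D.cubesPerDir (k + 1))).Dom, Z.1 ⊆ X₀.1 → ∀ ℓ ∈ (torusLabels hk Z).filter fun ℓ =>
        ℓ.Z₀ = trefineDom D.F.L (D.cubesPerDir (k + 1)) Z ∧
          ℓ.P ⊆ bondsOfFineCubes hk (ℓ.Z₀.1 \ ℓ.fam.biUnion fun Y : (tsys 4 (D.F.L * D.cubesPerDir (k + 1))).Dom => Y.1) ∧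
          (ℓ.Z₀.1 \ ℓ.fam.biUnion fun Y : (tsys 4 (D.F.L * D.cubesPerDir (k + 1))).Dom => Y.1).card ≤ 2 * ℓ.P.card,
      (coreOf P Op 𝒵 dom Jc V (coreLettersOf D P Op 𝒵 dom Jc V mI A) (domEmb D.toTwoRuns (k + 1) Z) (InnerLabel.ofTorus hk ℓ)).lam.real univ *
          ((coreOf P Op 𝒵 dom Jc V (coreLettersOf D P Op 𝒵 dom Jc V mI A) (domEmb D.toTwoRuns (k + 1) Z) (InnerLabel.ofTorus hk ℓ)).wB *
              (gaussC (mI (domEmb D.toTwoRuns (k + 1) Z) (InnerLabel.ofTorus hk ℓ)) *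
                Real.sqrt (max 1 ((Fintype.card (mI (domEmb D.toTwoRuns (k + 1) Z) (InnerLabel.ofTorus hk ℓ))).factorial *
                  β₀ (domEmb D.toTwoRuns (k + 1) Z) (InnerLabel.ofTorus hk ℓ) ^
                    Fintype.card (mI (domEmb D.toTwoRuns (k + 1) Z) (InnerLabel.ofTorus hk ℓ)) +
                  d₀ (domEmb D.toTwoRuns (k + 1) Z) (InnerLabel.ofTorus hk ℓ)))) * Real.exp 0) *
          (Real.pi / ((γ (domEmb D.toTwoRuns (k + 1) Z) (InnerLabel.ofTorus hk ℓ) -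
              Fintype.card (mI (domEmb D.toTwoRuns (k + 1) Z) (InnerLabel.ofTorus hk ℓ)) *
                ϑ (domEmb D.toTwoRuns (k + 1) Z) (InnerLabel.ofTorus hk ℓ) * R' (k + 1)) / 2 / 2)) ^
            (Module.finrank ℝ (V (domEmb D.toTwoRuns (k + 1) Z) (InnerLabel.ofTorus hk ℓ)) / 2 : ℝ) *
        Real.exp ((coreOf P Op 𝒵 dom Jc V (coreLettersOf D P Op 𝒵 dom Jc V mI A) (domEmb D.toTwoRuns (k + 1) Z)
          (InnerLabel.ofTorus hk ℓ)).N₁ * (‖h₀‖ + ϱ * ‖w‖)) ≤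
      (A₀ + ϱ * A₁) * ((∏ Y ∈ ℓ.fam, (α₆ * Real.exp (-(δ * κ * torusTreeLen Y.1)) *
        Real.exp (-(Rc * (torusTreeLen Y.1 + 5))))) * (s ^ 2 * t) ^ ℓ.P.card))
    (hϱ : 2 ≤ ϱ) (hϱA : A₀ ≤ ϱ * A₁) :
    ‖locE (tgeometry 4 (D.cubesPerDir (k + 1))).ι (tgeometry 4 (D.cubesPerDir (k + 1))).cubes
          (fun Z => ∑ ℓ ∈ (torusLabels hk Z).filter fun ℓ =>
              ℓ.Z₀ = trefineDom D.F.L (D.cubesPerDir (k + 1)) Z ∧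
                ℓ.P ⊆ bondsOfFineCubes hk (ℓ.Z₀.1 \ ℓ.fam.biUnion fun Y : (tsys 4 (D.F.L * D.cubesPerDir (k + 1))).Dom => Y.1) ∧
                (ℓ.Z₀.1 \ ℓ.fam.biUnion fun Y : (tsys 4 (D.F.L * D.cubesPerDir (k + 1))).Dom => Y.1).card ≤ 2 * ℓ.P.card,
            actOfLetters P Op 𝒵 dom Jc V (coreLettersOf D P Op 𝒵 dom Jc V mI A) (domEmb D.toTwoRuns (k + 1) Z)
              (InnerLabel.ofTorus hk ℓ) o (h₀ + w))
            ((tgeometry 4 (D.cubesPerDir (k + 1))).cubes X₀) -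
        locE (tgeometry 4 (D.cubesPerDir (k + 1))).ι (tgeometry 4 (D.cubesPerDir (k + 1))).cubes
          (fun Z => ∑ ℓ ∈ (torusLabels hk Z).filter fun ℓ =>
              ℓ.Z₀ = trefineDom D.F.L (D.cubesPerDir (k + 1)) Z ∧
                ℓ.P ⊆ bondsOfFineCubes hk (ℓ.Z₀.1 \ ℓ.fam.biUnion fun Y : (tsys 4 (D.F.L * D.cubesPerDir (k + 1))).Dom => Y.1) ∧
                (ℓ.Z₀.1 \ ℓ.fam.biUnion fun Y : (tsys 4 (D.F.L * D.cubesPerDir (k + 1))).Dom => Y.1).card ≤ 2 * ℓ.P.card,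
            actOfLetters P Op 𝒵 dom Jc V (coreLettersOf D P Op 𝒵 dom Jc V mI A) (domEmb D.toTwoRuns (k + 1) Z)
              (InnerLabel.ofTorus hk ℓ) o h₀)
            ((tgeometry 4 (D.cubesPerDir (k + 1))).cubes X₀)‖ ≤
      4 * (Real.exp 1 * 9 * 64 * K₀ 64 8 ^ 2) * A₁ * Real.exp (-(r₁ * (tsys 4 (D.cubesPerDir (k + 1))).dj X₀)) := by
  obtain ⟨hbud, hmq⟩ :=
    hbud_hmq_located (card := fun X j => Fintype.card (mI X j)) hcard hβ₀ hβb hϑ₀ hϑb hdb hγb hR' hR₁ hRd hRγ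
  exact attachedPart_locE_le_of_coreLettersOf_recordLabels D hk P Op 𝒵 dom Jc V mI A hroom hR' hbase hrdm hβ₀ hd₀ hrd hctr hbud hmq hg hO hH X₀ hA₀ hA₁ hr₁ hrate hsmall hα₆ hκ
    h229 hs0 hs1 ht hRR hAmp hϱ hϱA

open Classical in
/-- **S65 §1's μ-PART END WITH THE RADIUS SMALLNESSES LOCATED** (kernel; S65 §1 `muPart_locE_le_of_coreLettersOf_recordLabels` ONCE BY NAME
with `(hbud, hmq) := hbud_hmq_located …`).  Same supply; conclusion LITERALLY S65's = W91's μ-currency. [folklore] -/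
theorem muPart_locE_le_of_coreLettersOf_recordLabels_located {W : Set (ℕ → ℝ)}
    {ctr : ℕ → (ℕ → ℝ) → D.carriers.BgB → Op × B13HistM P} {ROp RHist R' : ℕ → ℝ}
    (A : ∀ X j, ActLetters D P Op 𝒵 dom Jc V mI X j)
    {β₀ ϑ d₀ γ : D.carriers.Dom → InnerLabel D.carriers.Dom (Bnd D.toTwoRuns) → ℝ}
    (hroom : ∀ k, ROp k < R' k) (hR' : ∀ k, 0 ≤ R' k)
    (hbase : ∀ X j ii jj, Measurable fun a => (A X j).base a ii jj)
    (hrdm : ∀ X j ii jj (o' : Op), Measurable fun a => (A X j).rd a ii jj o')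
    (hβ₀ : ∀ X j, 0 ≤ β₀ X j) (hd₀ : ∀ X j, 0 < d₀ X j)
    (hrd : ∀ X j a ii jj, ‖(A X j).rd a ii jj‖ ≤ ϑ X j)
    (hctr : ∀ k, ∀ g ∈ W, ∀ (U : D.carriers.BgB) (X : D.carriers.Dom) (j : InnerLabel D.carriers.Dom (Bnd D.toTwoRuns))
      (a : (Jc X j ⊕ 𝒵 X j) → ℝ × ℝ),
      (∀ ii jj, ‖linForm (A X j).base (A X j).rd (ctr k g U).1 a ii jj‖ ≤ β₀ X j) ∧
      ((linForm (A X j).base (A X j).rd (ctr k g U).1 a).det).im = 0 ∧ d₀ X j ≤ ((linForm (A X j).base (A X j).rd (ctr k g U).1 a).det).re ∧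
      (∀ x : mI X j → ℂ, γ X j * nsq x ≤ (star x ⬝ᵥ (linForm (A X j).base (A X j).rd (ctr k g U).1 a *ᵥ x)).re))
    -- the two radius smallnesses LOCATED (PART A `hbud_hmq_located`): UNIFORM letter bounds + THREE scalar clauses per level
    {mb : ℕ} {βb ϑb db γb : ℝ} (hcard : ∀ X j, Fintype.card (mI X j) ≤ mb) (hβb : ∀ X j, β₀ X j ≤ βb)
    (hϑ₀ : ∀ X j, 0 ≤ ϑ X j) (hϑb : ∀ X j, ϑ X j ≤ ϑb) (hdb : ∀ X j, db ≤ d₀ X j) (hγb : ∀ X j, γb ≤ γ X j)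
    (hR₁ : ∀ k, R' k ≤ 1) (hRd : ∀ k, mb.factorial * mb * max 1 (βb + ϑb) ^ (mb - 1) * ϑb * R' k < db)
    (hRγ : ∀ k, mb * ϑb * R' k < γb)
    {g : ℕ → ℝ} (hg : g ∈ W) {U : D.carriers.BgB} {o : Op} {h₀ v : B13HistM P} {μ₁ : ℝ}
    (hO : ‖o - (ctr (k + 1) g U).1‖ ≤ ROp (k + 1)) (hH : ‖h₀ - (ctr (k + 1) g U).2‖ + μ₁ * ‖v‖ ≤ RHist (k + 1))
    {A' Rkp r₁ μ₀ : ℝ} (X₀ : (tsys 4 (D.cubesPerDir (k + 1))).Dom) {sμ : ℂ} (hA : 0 ≤ A') (hr₁ : 0 ≤ r₁)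
    (hrate : r₁ + 2 * (64 * Real.log 162) + 2 ≤ Rkp)
    (hsmall : A' * Real.exp (5 * r₁ + 1) * K₀ 64 8 * 9 * 64 ≤ 1)
    {δ κ α₆ Rc s t : ℝ} (hα₆ : 0 ≤ α₆)
    (hκ : 64 * Real.log 162 + 1 ≤ δ * κ) (h229 : Real.exp 1 * K₀ 64 8 * 64 * α₆ ≤ 1)
    (hs0 : 0 ≤ s) (hs1 : s ≤ 1) (ht : 0 ≤ t)
    (hRR : Rkp ≤ Rc - 64 * (Real.exp (Rc * 5) * s * Real.exp ((4 * (D.F.L : ℝ) ^ (4 * D.m')) * t)))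
    (hAmp : ∀ Z : (tsys 4 (D.cubesPerDir (k + 1))).Dom, Z.1 ⊆ X₀.1 → ∀ ℓ ∈ (torusLabels hk Z).filter fun ℓ =>
        ℓ.Z₀ = trefineDom D.F.L (D.cubesPerDir (k + 1)) Z ∧
          ℓ.P ⊆ bondsOfFineCubes hk (ℓ.Z₀.1 \ ℓ.fam.biUnion fun Y : (tsys 4 (D.F.L * D.cubesPerDir (k + 1))).Dom => Y.1) ∧
          (ℓ.Z₀.1 \ ℓ.fam.biUnion fun Y : (tsys 4 (D.F.L * D.cubesPerDir (k + 1))).Dom => Y.1).card ≤ 2 * ℓ.P.card,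
      (coreOf P Op 𝒵 dom Jc V (coreLettersOf D P Op 𝒵 dom Jc V mI A) (domEmb D.toTwoRuns (k + 1) Z) (InnerLabel.ofTorus hk ℓ)).lam.real univ *
          ((coreOf P Op 𝒵 dom Jc V (coreLettersOf D P Op 𝒵 dom Jc V mI A) (domEmb D.toTwoRuns (k + 1) Z) (InnerLabel.ofTorus hk ℓ)).wB *
              (gaussC (mI (domEmb D.toTwoRuns (k + 1) Z) (InnerLabel.ofTorus hk ℓ)) *
                Real.sqrt (max 1 ((Fintype.card (mI (domEmb D.toTwoRuns (k + 1) Z) (InnerLabel.ofTorus hk ℓ))).factorial *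
                  β₀ (domEmb D.toTwoRuns (k + 1) Z) (InnerLabel.ofTorus hk ℓ) ^
                    Fintype.card (mI (domEmb D.toTwoRuns (k + 1) Z) (InnerLabel.ofTorus hk ℓ)) +
                  d₀ (domEmb D.toTwoRuns (k + 1) Z) (InnerLabel.ofTorus hk ℓ)))) * Real.exp 0) *
          (Real.pi / ((γ (domEmb D.toTwoRuns (k + 1) Z) (InnerLabel.ofTorus hk ℓ) -
              Fintype.card (mI (domEmb D.toTwoRuns (k + 1) Z) (InnerLabel.ofTorus hk ℓ)) *
                ϑ (domEmb D.toTwoRuns (k + 1) Z) (InnerLabel.ofTorus hk ℓ) * R' (k + 1)) / 2 / 2)) ^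
            (Module.finrank ℝ (V (domEmb D.toTwoRuns (k + 1) Z) (InnerLabel.ofTorus hk ℓ)) / 2 : ℝ) *
        Real.exp ((coreOf P Op 𝒵 dom Jc V (coreLettersOf D P Op 𝒵 dom Jc V mI A) (domEmb D.toTwoRuns (k + 1) Z)
          (InnerLabel.ofTorus hk ℓ)).N₁ * (‖h₀‖ + μ₁ * ‖v‖)) ≤
      A' * ((∏ Y ∈ ℓ.fam, (α₆ * Real.exp (-(δ * κ * torusTreeLen Y.1)) *
        Real.exp (-(Rc * (torusTreeLen Y.1 + 5))))) * (s ^ 2 * t) ^ ℓ.P.card))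
    (h0 : 0 < μ₀) (h01 : μ₀ < μ₁) (hμ : ‖sμ‖ ≤ μ₀) :
    ‖locE (tgeometry 4 (D.cubesPerDir (k + 1))).ι (tgeometry 4 (D.cubesPerDir (k + 1))).cubes
          (fun Z => ∑ ℓ ∈ (torusLabels hk Z).filter fun ℓ =>
              ℓ.Z₀ = trefineDom D.F.L (D.cubesPerDir (k + 1)) Z ∧
                ℓ.P ⊆ bondsOfFineCubes hk (ℓ.Z₀.1 \ ℓ.fam.biUnion fun Y : (tsys 4 (D.F.L * D.cubesPerDir (k + 1))).Dom => Y.1) ∧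
                (ℓ.Z₀.1 \ ℓ.fam.biUnion fun Y : (tsys 4 (D.F.L * D.cubesPerDir (k + 1))).Dom => Y.1).card ≤ 2 * ℓ.P.card,
            actOfLetters P Op 𝒵 dom Jc V (coreLettersOf D P Op 𝒵 dom Jc V mI A) (domEmb D.toTwoRuns (k + 1) Z)
              (InnerLabel.ofTorus hk ℓ) o (h₀ + sμ • v))
            ((tgeometry 4 (D.cubesPerDir (k + 1))).cubes X₀) -
        locE (tgeometry 4 (D.cubesPerDir (k + 1))).ι (tgeometry 4 (D.cubesPerDir (k + 1))).cubes
          (fun Z => ∑ ℓ ∈ (torusLabels hk Z).filter fun ℓ =>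
              ℓ.Z₀ = trefineDom D.F.L (D.cubesPerDir (k + 1)) Z ∧
                ℓ.P ⊆ bondsOfFineCubes hk (ℓ.Z₀.1 \ ℓ.fam.biUnion fun Y : (tsys 4 (D.F.L * D.cubesPerDir (k + 1))).Dom => Y.1) ∧
                (ℓ.Z₀.1 \ ℓ.fam.biUnion fun Y : (tsys 4 (D.F.L * D.cubesPerDir (k + 1))).Dom => Y.1).card ≤ 2 * ℓ.P.card,
            actOfLetters P Op 𝒵 dom Jc V (coreLettersOf D P Op 𝒵 dom Jc V mI A) (domEmb D.toTwoRuns (k + 1) Z)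
              (InnerLabel.ofTorus hk ℓ) o h₀)
            ((tgeometry 4 (D.cubesPerDir (k + 1))).cubes X₀)‖ ≤
      Real.exp 1 * 9 * 64 * K₀ 64 8 ^ 2 * A' * Real.exp (-(r₁ * (tsys 4 (D.cubesPerDir (k + 1))).dj X₀)) * (μ₀ / (μ₁ - μ₀)) := by
  obtain ⟨hbud, hmq⟩ :=
    hbud_hmq_located (card := fun X j => Fintype.card (mI X j)) hcard hβ₀ hβb hϑ₀ hϑb hdb hγb hR' hR₁ hRd hRγ
  exact muPart_locE_le_of_coreLettersOf_recordLabels D hk P Op 𝒵 dom Jc V mI A hroom hR' hbase hrdm hβ₀ hd₀ hrd hctr hbud hmq hg hO hH X₀ hA hr₁ hrate hsmall hα₆ hκ h229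
    hs0 hs1 ht hRR hAmp h0 h01 hμ

end Located

end Summit.QuantumFields.BalabanUV.T4Continuum.NE1p.DressedSmallFieldRecordLabelsKillSlotLettersLocated

end
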